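import Mathlib
import HarnessLib
import Summits.HubbardSuperconductivity.HubbardSuperconductivity.Theorems.KLProgrammeKLRegimeSectorSliceRows
import Summits.HubbardSuperconductivity.HubbardSuperconductivity.Theorems.KLProgrammeKLRegimeTorusL1SecondDifferences

/-!
# Route `KLProgramme` — engine support (route (L2), ADDITIVE weight): the `ℓ¹` norm of ONE sector-pair character sum of the sectorised slice
# covariance from MULTIPLIER DATA (sup / first / second differences of `F_ω F_{ω′}` on the product torus, support count) and the landed
# PROPAGATOR DATA — the per-pair assembly behind `α_n`

Cell `gate-hubbard-kl`, seat hubbard-kl-k3c2-p3 (row «sector-counting import (DR2000 L11/L12) for the leg-dress bar»), for the ENGINE child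
stmt-HubbardSuperconductivity-19823 (`stub_engine_step_norms`, propagator constant `α_n`).  By `KLProgrammeKLRegimeSectorSliceRows` the row/column
sums of `Sᵀ(F)·C^K_{(Λ,Λ′]}·S(F)` are `≤ 8·Σ_{ω′} T(ω,ω′)`, `T(ω,ω′) = Σ_z ‖Σ_q χ_{q₁}(z₁)χ_{q₂}(z₂) • G_{ωω′}(q)‖`,
`G_{ωω′} = (βL²)⁻²·M_{ωω′}·Ψ̂`, `M_{ωω′}(q) = F_ω(k_q)F_{ω′}(k_q)` (the multiplier product, p4 lineage (b₂)/(b₃)), `Ψ̂` the slice profile through the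
frame band (`KLProgrammeKLRegimeSliceSymbolTorus`).  Here:

* §1 **`norm_fwdDiff_iter_two_smul_mul_le_of_support`** (and order one / zero): pointwise bounds of `Δ_w²(c₀·M·Ψ)` from bounds of `M, Δ_wM, Δ_w²M`
  everywhere and of `Ψ, Δ_wΨ, Δ_w²Ψ` ONLY on the `w`-neighbourhood `{q : ∃ j ≤ 2, M(q + j•w) ≠ 0}` of the support of `M` (discrete Leibniz;
  off that set the difference vanishes) — the anisotropic smallness of the propagator's first-order term is only available there;
* §2 `card_support_smul_mul_le` — `#{G ≠ 0} ≤ #{M ≠ 0}`;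
* §3 **`sliceCharSum_l1_le_of_data`** — the per-pair bound: given rates `s₀,…,s₃`, an integer frame `(v⊥, v)`, a near radius, a support
  count `N_s` for `M`, and for each of the five directions the inequality «Leibniz bound ≤ A₀·(4/(s_wP_w))²» with `A₀ = (βL²)⁻²·b₀`,
  `T(ω,ω′) ≤ √(2048(1/s₀+1)[…])·√(16·2M·L²·N_s)·A₀` (the master lemma `sum_norm_charSum_le_of_second_differences`).

The numeric choice of rates for the engine's families on an admissible frame (tangent vector `|v| ≍ 2ⁿ`, `s₀ ≍ Λβ/2M`, `s₁ ≍ s₂|v| ≍ Λ`,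
`s₃|v| ≍ 2^{−n}`) is the final instance, fed by p4's sector-cell support count and multiplier differences.  Everything is proved; no definitions,
no named facts. [folklore]

References: G. Benfatto, A. Giuliani, V. Mastropietro, Ann. Henri Poincaré 7 (2006) 809–898, §2.8 (2.81), Lemma 2.2 and footnote ¹; M. Disertori,
V. Rivasseau, Comm. Math. Phys. 215 (2000) 251–290, §IV.2 Lemma 4, App. A Lemma 12.
-/

noncomputable section

namespace Summit.HubbardSuperconductivity.HubbardSuperconductivity.Theorems.TorusFourierL2

set_option linter.dupNamespace false -- summit = problem name (single-conjunct summit), D-0017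

open Finset Complex Literature.MathematicalPhysics.QuantumLattice Literature.Probability.LatticeModels
open scoped Real

/-! ### §1 Pointwise differences of `c₀·M·Ψ` with propagator data only near the support of `M` -/

section Product

variable {A : Type*} [AddCommMonoid A]

/-- **Second difference of `c₀·(M·Ψ)`** with `‖M‖ ≤ a₀`, `‖Δ_wM‖ ≤ a₁`, `‖Δ_w²M‖ ≤ a₂` everywhere and `‖Ψ‖ ≤ b₀`, `‖Δ_wΨ‖ ≤ b₁`, `‖Δ_w²Ψ‖ ≤ b₂`
at the points `q` with `M(q + j•w) ≠ 0` for some `j ≤ 2`: `‖Δ_w²(c₀·M·Ψ)(q)‖ ≤ ‖c₀‖·(a₀b₂ + 2a₁b₁ + a₂b₀)` at EVERY `q`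
(elsewhere all three Leibniz terms vanish). [folklore] -/
theorem norm_fwdDiff_iter_two_smul_mul_le_of_support (w : A) (c₀ : ℂ) (Mf Ψ : A → ℂ) {a₀ a₁ a₂ b₀ b₁ b₂ : ℝ}
    (ha0 : 0 ≤ a₀) (ha1 : 0 ≤ a₁) (ha2 : 0 ≤ a₂) (hb0 : 0 ≤ b₀) (hb1 : 0 ≤ b₁) (hb2 : 0 ≤ b₂)
    (hM0 : ∀ x, ‖Mf x‖ ≤ a₀) (hM1 : ∀ x, ‖fwdDiff w Mf x‖ ≤ a₁) (hM2 : ∀ x, ‖(fwdDiff w)^[2] Mf x‖ ≤ a₂)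
    (hΨ0 : ∀ x, (∃ j : ℕ, j ≤ 2 ∧ Mf (x + j • w) ≠ 0) → ‖Ψ x‖ ≤ b₀)
    (hΨ1 : ∀ x, (∃ j : ℕ, j ≤ 2 ∧ Mf (x + j • w) ≠ 0) → ‖fwdDiff w Ψ x‖ ≤ b₁)
    (hΨ2 : ∀ x, (∃ j : ℕ, j ≤ 2 ∧ Mf (x + j • w) ≠ 0) → ‖(fwdDiff w)^[2] Ψ x‖ ≤ b₂) (x : A) :
    ‖(fwdDiff w)^[2] (fun y => c₀ * (Mf y * Ψ y)) x‖ ≤ ‖c₀‖ * (a₀ * b₂ + 2 * (a₁ * b₁) + a₂ * b₀) := by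
  -- pull out the constant
  have hlin : (fwdDiff w)^[2] (fun y => c₀ * (Mf y * Ψ y)) x = c₀ * (fwdDiff w)^[2] (fun y => Mf y * Ψ y) x := by
    simp only [fwdDiff_iter_eq_sum_shift, Finset.mul_sum, zsmul_eq_mul]
    refine Finset.sum_congr rfl fun k _ => by ring
  rw [hlin, norm_mul]
  refine mul_le_mul_of_nonneg_left ?_ (norm_nonneg _)
  by_cases hnear : ∃ j : ℕ, j ≤ 2 ∧ Mf (x + j • w) ≠ 0
  · rw [fwdDiff_iter_two_mul_apply]
    have h2w : x + w + w = x + 2 • w := by rw [two_nsmul, add_assoc]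
    have h1w : x + w = x + 1 • w := by rw [one_nsmul]
    refine (norm_add_le _ _).trans (add_le_add ((norm_add_le _ _).trans (add_le_add ?_ ?_)) ?_)
    · rw [norm_mul]; exact mul_le_mul (hM0 _) (hΨ2 x hnear) (norm_nonneg _) ha0
    · rw [norm_mul, norm_mul, Complex.norm_two]
      exact mul_le_mul_of_nonneg_left (mul_le_mul (hM1 _) (hΨ1 x hnear) (norm_nonneg _) ha1) zero_le_two
    · rw [norm_mul]; exact mul_le_mul (hM2 _) (hΨ0 x hnear) (norm_nonneg _) ha2
  · -- all of `M(x)`, `M(x+w)`, `M(x+2w)` vanish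
    push Not at hnear
    have h0 : Mf x = 0 := by simpa using hnear 0 (by norm_num)
    have h1 : Mf (x + w) = 0 := by simpa using hnear 1 (by norm_num)
    have h2 : Mf (x + w + w) = 0 := by
      have := hnear 2 le_rfl; rwa [two_nsmul, ← add_assoc] at this
    have hz : (fwdDiff w)^[2] (fun y => Mf y * Ψ y) x = 0 := by
      simp only [Function.iterate_succ_apply', Function.iterate_zero_apply, fwdDiff, h0, h1, h2, zero_mul, sub_zero]
    rw [hz, norm_zero]
    positivity

/-- **First difference of `c₀·(M·Ψ)`**: `‖Δ_w(c₀·M·Ψ)(q)‖ ≤ ‖c₀‖·(a₀b₁ + a₁b₀)`, with the propagator data needed only where `M(q + j•w) ≠ 0`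
for some `j ≤ 1`. [folklore] -/
theorem norm_fwdDiff_smul_mul_le_of_support (w : A) (c₀ : ℂ) (Mf Ψ : A → ℂ) {a₀ a₁ b₀ b₁ : ℝ}
    (ha0 : 0 ≤ a₀) (ha1 : 0 ≤ a₁) (hb0 : 0 ≤ b₀) (hb1 : 0 ≤ b₁)
    (hM0 : ∀ x, ‖Mf x‖ ≤ a₀) (hM1 : ∀ x, ‖fwdDiff w Mf x‖ ≤ a₁)
    (hΨ0 : ∀ x, (∃ j : ℕ, j ≤ 1 ∧ Mf (x + j • w) ≠ 0) → ‖Ψ x‖ ≤ b₀)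
    (hΨ1 : ∀ x, (∃ j : ℕ, j ≤ 1 ∧ Mf (x + j • w) ≠ 0) → ‖fwdDiff w Ψ x‖ ≤ b₁) (x : A) :
    ‖fwdDiff w (fun y => c₀ * (Mf y * Ψ y)) x‖ ≤ ‖c₀‖ * (a₀ * b₁ + a₁ * b₀) := by
  have hlin : fwdDiff w (fun y => c₀ * (Mf y * Ψ y)) x = c₀ * fwdDiff w (fun y => Mf y * Ψ y) x := by
    simp only [fwdDiff]; ring
  rw [hlin, norm_mul]
  refine mul_le_mul_of_nonneg_left ?_ (norm_nonneg _)
  by_cases hnear : ∃ j : ℕ, j ≤ 1 ∧ Mf (x + j • w) ≠ 0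
  · rw [fwdDiff_mul_apply]
    refine (norm_add_le _ _).trans (add_le_add ?_ ?_)
    · rw [norm_mul]; exact mul_le_mul (hM0 _) (hΨ1 x hnear) (norm_nonneg _) ha0
    · rw [norm_mul]; exact mul_le_mul (hM1 _) (hΨ0 x hnear) (norm_nonneg _) ha1
  · push Not at hnear
    have h0 : Mf x = 0 := by simpa using hnear 0 (by norm_num)
    have h1 : Mf (x + w) = 0 := by simpa using hnear 1 le_rfl
    have hz : fwdDiff w (fun y => Mf y * Ψ y) x = 0 := by
      simp only [fwdDiff, h0, h1, zero_mul, sub_zero]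
    rw [hz, norm_zero]
    positivity

omit [AddCommMonoid A] in
/-- **Sup of `c₀·(M·Ψ)`**: `‖c₀·M·Ψ‖ ≤ ‖c₀‖·a₀·b₀` with `‖Ψ‖ ≤ b₀` needed only on the support of `M`. [folklore] -/
theorem norm_smul_mul_le_of_support (c₀ : ℂ) (Mf Ψ : A → ℂ) {a₀ b₀ : ℝ} (ha0 : 0 ≤ a₀) (hb0 : 0 ≤ b₀)
    (hM0 : ∀ x, ‖Mf x‖ ≤ a₀) (hΨ0 : ∀ x, Mf x ≠ 0 → ‖Ψ x‖ ≤ b₀) (x : A) :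
    ‖c₀ * (Mf x * Ψ x)‖ ≤ ‖c₀‖ * (a₀ * b₀) := by
  rw [norm_mul]
  refine mul_le_mul_of_nonneg_left ?_ (norm_nonneg _)
  by_cases h : Mf x = 0
  · rw [h, zero_mul, norm_zero]; positivity
  · rw [norm_mul]; exact mul_le_mul (hM0 x) (hΨ0 x h) (norm_nonneg _) ha0

end Product

/-! ### §2 Support -/

/-- The support of `c₀·(M·Ψ)` is inside the support of `M`. [folklore] -/
theorem card_support_smul_mul_le {A : Type*} [Fintype A] [DecidableEq A] (c₀ : ℂ) (Mf Ψ : A → ℂ) :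
    (univ.filter fun x => c₀ * (Mf x * Ψ x) ≠ 0).card ≤ (univ.filter fun x => Mf x ≠ 0).card := by
  refine card_le_card fun x hx => ?_
  rw [mem_filter] at hx ⊢
  refine ⟨hx.1, fun h => hx.2 ?_⟩
  rw [h, zero_mul, mul_zero]

/-! ### §3 The per-pair bound from data -/

/-- **The `ℓ¹` norm of one sector-pair character sum from data.**  Symbol `G(q) = c₀·(M(q)·Ψ(q))` on `(ℤ/P)¹ × (ℤ/L)²`; multiplier data:
`#{M ≠ 0} ≤ N_s`, `‖M‖ ≤ 1`; for each of the five directions `w ∈ {(1,0), (0,e₁), (0,e₂), (0,v⊥), (0,v)}` a bound `D_w` of the second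
difference of `G` (obtained from §1) with `D_w ≤ A₀·(4/(s_wP_w))²`, and `‖G‖ ≤ A₀`.  THEN
`Σ_z ‖Σ_q χ_{q₁}(z₁)χ_{q₂}(z₂) • G(q)‖ ≤ √(2048(1/s₀+1)[4(2√2/(s₂|v|)+2)(2√2/(s₃|v|)+2) + 16(1/s₁+1)²/(1+s₁R₀)]) · √(16·P·L²·N_s) · A₀` — the master
lemma with the support of `G` controlled by that of `M`. [cite: BenfattoGiulianiMastropietro2006, §2.8 (2.81)] -/
theorem sliceCharSum_l1_le_of_data {P L : ℕ} [NeZero P] [NeZero L] (c₀ : ℂ) (Mf Ψ : TorusSite 1 P × TorusSite 2 L → ℂ)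
    (v : Fin 2 → ℤ) (hv : v ≠ 0) {s₀ s₁ s₂ s₃ : ℝ} (hs₀ : 0 < s₀) (hs₁ : 0 < s₁) (hs₂ : 0 < s₂) (hs₃ : 0 < s₃)
    {R₀ : ℕ} (hR₀ : 2 * (|v 0| + |v 1|) * (R₀ : ℤ) < L) {A₀ : ℝ} (hA₀ : 0 ≤ A₀) {Ns : ℕ}
    (hsupp : (univ.filter fun q => Mf q ≠ 0).card ≤ Ns)
    (hsup : ∀ q, ‖c₀ * (Mf q * Ψ q)‖ ≤ A₀)
    (h₀ : ∀ q, ‖(fwdDiff ((fun _ : Fin 1 => (1 : ZMod P)), (0 : TorusSite 2 L)))^[2] (fun y => c₀ * (Mf y * Ψ y)) q‖ ≤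
      A₀ * (4 / (s₀ * P)) ^ 2)
    (h₁ : ∀ q (i : Fin 2), ‖(fwdDiff ((0 : TorusSite 1 P), (Pi.single i (1 : ZMod L) : TorusSite 2 L)))^[2]
        (fun y => c₀ * (Mf y * Ψ y)) q‖ ≤ A₀ * (4 / (s₁ * L)) ^ 2)
    (h₂ : ∀ q, ‖(fwdDiff ((0 : TorusSite 1 P), (fun j => ((![-v 1, v 0] j : ℤ) : ZMod L))))^[2]
        (fun y => c₀ * (Mf y * Ψ y)) q‖ ≤ A₀ * (4 / (s₂ * L)) ^ 2)
    (h₃ : ∀ q, ‖(fwdDiff ((0 : TorusSite 1 P), (fun j => ((v j : ℤ) : ZMod L))))^[2] (fun y => c₀ * (Mf y * Ψ y)) q‖ ≤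
        A₀ * (4 / (s₃ * L)) ^ 2) :
    ∑ z : TorusSite 1 P × TorusSite 2 L,
        ‖∑ q : TorusSite 1 P × TorusSite 2 L, (torusChar q.1 z.1 * torusChar q.2 z.2) • (c₀ * (Mf q * Ψ q))‖ ≤
      Real.sqrt (2048 * (1 / s₀ + 1) *
          (4 * ((2 * Real.sqrt 2 / (s₂ * Real.sqrt ((v 0 : ℝ) ^ 2 + (v 1 : ℝ) ^ 2)) + 2) *
              (2 * Real.sqrt 2 / (s₃ * Real.sqrt ((v 0 : ℝ) ^ 2 + (v 1 : ℝ) ^ 2)) + 2))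
            + 16 * (1 / s₁ + 1) ^ 2 / (1 + s₁ * R₀))) *
        Real.sqrt (16 * P * (L : ℝ) ^ 2 * Ns) * A₀ := by
  classical
  exact sum_norm_charSum_le_of_second_differences (fun q => c₀ * (Mf q * Ψ q)) v hv hs₀ hs₁ hs₂ hs₃ hR₀ hA₀
    ((card_support_smul_mul_le c₀ Mf Ψ).trans hsupp) hsup h₀ h₁ h₂ h₃

/-! ### §4 From per-pair bounds to the row/column constant: only overlapping pairs contribute -/

/-- **A character sum with identically vanishing symbol is zero**: if `M ≡ 0` (disjoint multiplier supports) the per-pair `ℓ¹` norm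
vanishes. [folklore] -/
theorem sliceCharSum_l1_eq_zero_of_mul_eq_zero {P L : ℕ} [NeZero P] [NeZero L] (c₀ : ℂ) (Mf Ψ : TorusSite 1 P × TorusSite 2 L → ℂ)
    (hM : ∀ q, Mf q = 0) :
    ∑ z : TorusSite 1 P × TorusSite 2 L,
        ‖∑ q : TorusSite 1 P × TorusSite 2 L, (torusChar q.1 z.1 * torusChar q.2 z.2) • (c₀ * (Mf q * Ψ q))‖ = 0 := by
  refine Finset.sum_eq_zero fun z _ => ?_
  rw [norm_eq_zero]
  exact Finset.sum_eq_zero fun q _ => by rw [hM q, zero_mul, mul_zero, smul_zero]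

/-- **Summing per-pair bounds over the partner sector**: if `T ω ω′ ≤ T_max` for all pairs, `T ω ω′ = 0` unless `ω′` is adjacent to `ω`,
and every sector has at most `novl` adjacent ones, then `Σ_{ω′} T ω ω′ ≤ novl · T_max`. [folklore] -/
theorem sum_pair_le_of_overlap {N : ℕ} (T : Fin N → Fin N → ℝ) (Adj : Fin N → Fin N → Prop) [DecidableRel Adj] {Tmax : ℝ}
    (hTmax : 0 ≤ Tmax) (hT : ∀ ω ω', T ω ω' ≤ Tmax) (hzero : ∀ ω ω', ¬ Adj ω ω' → T ω ω' = 0) {novl : ℕ}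
    (hcard : ∀ ω, (univ.filter fun ω' => Adj ω ω').card ≤ novl) (ω : Fin N) :
    ∑ ω' : Fin N, T ω ω' ≤ novl * Tmax := by
  classical
  have hsplit : ∑ ω' : Fin N, T ω ω' = ∑ ω' ∈ univ.filter (fun ω' => Adj ω ω'), T ω ω' := by
    rw [Finset.sum_filter]
    refine Finset.sum_congr rfl fun ω' _ => ?_
    split_ifs with h
    · rfl
    · exact hzero ω ω' h
  rw [hsplit]
  calc ∑ ω' ∈ univ.filter (fun ω' => Adj ω ω'), T ω ω' ≤ ∑ _ω' ∈ univ.filter (fun ω' => Adj ω ω'), Tmax :=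
        Finset.sum_le_sum fun ω' _ => hT ω ω'
    _ = ((univ.filter fun ω' => Adj ω ω').card : ℝ) * Tmax := by rw [Finset.sum_const, nsmul_eq_mul]
    _ ≤ novl * Tmax := by
        have hc : ((univ.filter fun ω' => Adj ω ω').card : ℝ) ≤ novl := by exact_mod_cast hcard ω
        exact mul_le_mul_of_nonneg_right hc hTmax

/-- The same with the roles of the two sectors exchanged (column sums). [folklore] -/
theorem sum_pair_le_of_overlap' {N : ℕ} (T : Fin N → Fin N → ℝ) (Adj : Fin N → Fin N → Prop) [DecidableRel Adj] {Tmax : ℝ}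
    (hTmax : 0 ≤ Tmax) (hT : ∀ ω ω', T ω ω' ≤ Tmax) (hzero : ∀ ω ω', ¬ Adj ω ω' → T ω ω' = 0) {novl : ℕ}
    (hcard : ∀ ω', (univ.filter fun ω => Adj ω ω').card ≤ novl) (ω' : Fin N) :
    ∑ ω : Fin N, T ω ω' ≤ novl * Tmax :=
  sum_pair_le_of_overlap (fun a b => T b a) (fun a b => Adj b a) hTmax (fun a b => hT b a) (fun a b h => hzero b a h) hcard ω'

end Summit.HubbardSuperconductivity.HubbardSuperconductivity.Theorems.TorusFourierL2

end
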